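/-
Copyright (c) 2026. All rights reserved.
Released under Apache 2.0 license as described in the file LICENSE.
-/
import Summits.KontsevichZagierPeriods.KontsevichZagierPeriods.Theorems.SoloInformedSumStar

/-!
# PROGRAMME XLI, file 1 — the stuffle in `𝒫`: cut products, pull-backs along `κ`, domination

The stuffle `ζ(a)ζ(b) = ζ(a,b) + ζ(b,a) + ζ(a+b)` between ABSTRACT periods (classes in
`KZ.FormalPeriodRing`) is obtained from the cube representations `[(0,1)ᶜ⁺², 1/(1 − x₀⋯x_{c+1})]`
of `ζ(c+2)` by ONE partial-fraction identity with a CUT PARAMETER.  For `x ∈ (0,1)ⁿ⁺⁴` and a cut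
`K` put `X_K = ∏_{l ≤ K} x_l` (prefix product), `Y_K = ∏_{l > K} x_l` (suffix product) and
`P = ∏ x_l = X_K Y_K`.  Since `1 − P = (1 − X_K) + X_K (1 − Y_K)`,

  `1/((1 − X_K)(1 − Y_K)) = X_K/((1 − X_K)(1 − P)) + 1/((1 − Y_K)(1 − P))`        (rule (1b)),

and along the prefix-product chart `κ` (rule (2)) the word of `Z(K+1, n+3−K)` pulls back to the
first summand EXACTLY: with `t = κ(x)` one has `det J_κ = ∏_{k ≠ last} t_k`, the word has its two
letters `ω₁` at the slots `K` and `last`, and `(∏ₖ ω_{εₖ}(tₖ)) · ∏_{k ≠ last} tₖ = t_K/((1−t_K)(1−t_last))`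
is finset algebra (`soloInformed_cutWord_mul`).  This file: the products and their bounds (§1),
the determinant and the two pull-back identities (§2), the four integrands with their domination
by the half weight `W_{1/2}` (§3).  The representations, moves and classes are in
`SoloInformedStuffleReps`, the stuffle itself in `SoloInformedStuffle`.
-/

noncomputable section

open MeasureTheory Set MvPolynomial
open Literature.ModelTheory.ExponentialFields Literature.NumberTheory.Transcendental
open Literature.NumberTheory.Transcendental.KZ

namespace Summit.KontsevichZagierPeriods.KontsevichZagierPeriods.Theorems

/-! ## 1. Sub-products of numbers in `(0,1)` -/

section products

variable {m : ℕ}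

/-- The suffix product `Y_K(x) = ∏_{l > K} x_l`. -/
def soloInformedSuffixProd {A : Type*} [CommMonoid A] (x : Fin m → A) (K : Fin m) : A :=
  ∏ i ∈ Finset.univ.filter (fun i : Fin m => K < i), x i

/-- The suffix-product polynomial. -/
def soloInformedSuffixPoly (m : ℕ) (K : Fin m) : MvPolynomial (Fin m) ℚ :=
  soloInformedSuffixProd MvPolynomial.X K

/-- Evaluation of the suffix-product polynomial. -/
@[simp] theorem soloInformed_aeval_suffixPoly (x : Fin m → ℝ) (K : Fin m) :
    aeval x (soloInformedSuffixPoly m K) = soloInformedSuffixProd x K := by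
  simp [soloInformedSuffixPoly, soloInformedSuffixProd, map_prod]

/-- A product over a larger finset of numbers in `(0,1)` is smaller. -/
theorem soloInformed_prod_le_prod_of_subset {x : Fin m → ℝ} (hx : x ∈ soloInformedOpenCube m)
    {S T : Finset (Fin m)} (hTS : T ⊆ S) : ∏ i ∈ S, x i ≤ ∏ i ∈ T, x i := by
  rw [← Finset.prod_sdiff hTS]
  exact mul_le_of_le_one_left (Finset.prod_nonneg fun i _ => (hx i).1.le)
    (Finset.prod_le_one (fun i _ => (hx i).1.le) fun i _ => (hx i).2.le)

/-- A product over a nonempty finset of numbers in `(0,1)` is `< 1`. -/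
theorem soloInformed_prod_lt_one {x : Fin m → ℝ} (hx : x ∈ soloInformedOpenCube m)
    {S : Finset (Fin m)} {j : Fin m} (hj : j ∈ S) : ∏ i ∈ S, x i < 1 := by
  have h := soloInformed_prod_le_prod_of_subset hx (Finset.singleton_subset_iff.2 hj)
  rw [Finset.prod_singleton] at h
  exact h.trans_lt (hx j).2

/-- The half weight factor `(1 − xⱼ)^{−1/2}`. -/
def soloInformedHalfW (x : Fin m → ℝ) (j : Fin m) : ℝ := (1 - x j) ^ (-(1 / 2 : ℝ))

/-- `W_{1/2} = ∏ⱼ (1 − xⱼ)^{−1/2}`. -/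
theorem soloInformedW_half_eq (x : Fin m → ℝ) :
    soloInformedW (fun _ => 1 / 2) x = ∏ j, soloInformedHalfW x j := rfl

variable {x : Fin m → ℝ} (hx : x ∈ soloInformedOpenCube m)
include hx

/-- `(1 − xⱼ)^{−1/2} ≥ 1`. -/
theorem soloInformed_one_le_halfW (j : Fin m) : 1 ≤ soloInformedHalfW x j :=
  Real.one_le_rpow_of_pos_of_le_one_of_nonpos (by linarith [(hx j).2]) (by linarith [(hx j).1])
    (by norm_num)

/-- `(1 − xⱼ)^{−1/2} ≥ 0`. -/
theorem soloInformed_halfW_nonneg (j : Fin m) : 0 ≤ soloInformedHalfW x j :=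
  zero_le_one.trans (soloInformed_one_le_halfW hx j)

/-- **Any sub-product of half factors is dominated by the full half weight.** -/
theorem soloInformed_prod_halfW_le_W (S : Finset (Fin m)) :
    ∏ j ∈ S, soloInformedHalfW x j ≤ soloInformedW (fun _ => 1 / 2) x := by
  rw [soloInformedW_half_eq, ← Finset.prod_mul_prod_compl S]
  refine le_mul_of_one_le_right (Finset.prod_nonneg fun j _ => soloInformed_halfW_nonneg hx j) ?_
  have h := Finset.prod_le_prod (s := Sᶜ) (f := fun _ => (1 : ℝ)) (g := soloInformedHalfW x)
    (fun j _ => zero_le_one) fun j _ => soloInformed_one_le_halfW hx j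
  rwa [Finset.prod_const_one] at h

/-- **`1/(1 − q) ≤ (1−xᵢ)^{−1/2}(1−xⱼ)^{−1/2}` whenever `q ≤ xᵢ xⱼ`.** -/
theorem soloInformed_one_div_le_halfW (i j : Fin m) {q : ℝ} (hq : q ≤ x i * x j) :
    1 / (1 - q) ≤ soloInformedHalfW x i * soloInformedHalfW x j := by
  have hi := hx i; have hj := hx j
  have hp := soloInformed_one_div_one_sub_mul_le (α := 1 / 2) (β := 1 / 2) hi.1.le hi.2 hj.1.le
    hj.2 (by norm_num) (by norm_num) (by norm_num)
  exact (one_div_le_one_div_of_le (by nlinarith [mul_pos hi.1 hj.1, hi.2, hj.2]) (by linarith)).trans hp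

/-- Four distinct half factors are dominated by `W_{1/2}`. -/
theorem soloInformed_halfW_four_le_W {i j k l : Fin m} (hij : i ≠ j) (hik : i ≠ k) (hil : i ≠ l)
    (hjk : j ≠ k) (hjl : j ≠ l) (hkl : k ≠ l) :
    soloInformedHalfW x i * soloInformedHalfW x j * (soloInformedHalfW x k * soloInformedHalfW x l) ≤
      soloInformedW (fun _ => 1 / 2) x := by
  have h : ∏ a ∈ ({i, j, k, l} : Finset (Fin m)), soloInformedHalfW x a =
      soloInformedHalfW x i * soloInformedHalfW x j *
        (soloInformedHalfW x k * soloInformedHalfW x l) := by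
    rw [Finset.prod_insert (by simp [hij, hik, hil]), Finset.prod_insert (by simp [hjk, hjl]),
      Finset.prod_pair hkl]; ring
  rw [← h]
  exact soloInformed_prod_halfW_le_W hx _

/-- Two half factors are dominated by `W_{1/2}`. -/
theorem soloInformed_halfW_two_le_W {i j : Fin m} (hij : i ≠ j) :
    soloInformedHalfW x i * soloInformedHalfW x j ≤ soloInformedW (fun _ => 1 / 2) x := by
  rw [← Finset.prod_pair hij]
  exact soloInformed_prod_halfW_le_W hx _

/-- `X_K ≤ x_K < 1`, so `0 < 1 − X_K`. -/
theorem soloInformed_one_sub_prefix_pos (K : Fin m) : 0 < 1 - soloInformedPrefixProd x K := by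
  have h : soloInformedPrefixProd x K < 1 := soloInformed_prod_lt_one hx (j := K) (by simp)
  linarith

end products

/-! ## 2. The determinant of `κ` and the two pull-back identities -/

section pullback

variable {m : ℕ}

/-- `det J_κ(x) = ∏_{i < m} t_{i}` with `t = κ(x)` the prefix products (all but the last one). -/
theorem soloInformed_det_kappa_castSucc (x : Fin (m + 1) → ℝ) :
    (soloInformedJacCLM (soloInformedMonoPoly (m + 1)) x).det =
      ∏ i : Fin m, soloInformedPrefixProd x (Fin.castSucc i) := by
  rw [soloInformed_det_jacCLM_kappa, Fin.prod_univ_succ]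
  have h0 : Finset.univ.filter (fun l : Fin (m + 1) => l < 0) = ∅ := by
    ext l; simp
  rw [h0, Finset.prod_empty, one_mul]
  refine Finset.prod_congr rfl fun i _ => ?_
  unfold soloInformedPrefixProd
  congr 1
  ext l
  simp only [Finset.mem_filter, Finset.mem_univ, true_and, Fin.lt_def, Fin.le_def, Fin.val_succ,
    Fin.val_castSucc]
  omega

/-- **Top word**: `(∏ₖ ω_{[k = last]}(tₖ)) · ∏_{i<m} t_i = 1/(1 − t_last)`. -/
theorem soloInformed_topWord_mul (t : Fin (m + 1) → ℝ) (ht : ∀ k, t k ≠ 0) :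
    (∏ k : Fin (m + 1), mzvForm (decide (k = Fin.last m)) (t k)) * ∏ i : Fin m, t (Fin.castSucc i) =
      1 / (1 - t (Fin.last m)) := by
  have hl : mzvForm (decide (Fin.last m = Fin.last m)) (t (Fin.last m)) = 1 / (1 - t (Fin.last m)) := by
    simp
  have hc : ∀ i : Fin m, mzvForm (decide (Fin.castSucc i = Fin.last m)) (t (Fin.castSucc i)) =
      1 / t (Fin.castSucc i) := fun i => by simp [(Fin.castSucc_lt_last i).ne]
  rw [Fin.prod_univ_castSucc, hl, Finset.prod_congr rfl fun i _ => hc i]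
  have h1 : (∏ i : Fin m, 1 / t (Fin.castSucc i)) * ∏ i : Fin m, t (Fin.castSucc i) = 1 := by
    rw [← Finset.prod_mul_distrib]
    exact Finset.prod_eq_one fun i _ => by simp [ht (Fin.castSucc i)]
  calc (∏ i : Fin m, 1 / t (Fin.castSucc i)) * (1 / (1 - t (Fin.last m))) *
        ∏ i : Fin m, t (Fin.castSucc i)
      = (∏ i : Fin m, 1 / t (Fin.castSucc i)) * (∏ i : Fin m, t (Fin.castSucc i)) *
        (1 / (1 - t (Fin.last m))) := by ring
    _ = 1 / (1 - t (Fin.last m)) := by rw [h1, one_mul]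

/-- **Cut word**: `(∏ₖ ω_{[k = K ∨ k = last]}(tₖ)) · ∏_{i<m} t_i = t_K/((1 − t_K)(1 − t_last))`. -/
theorem soloInformed_cutWord_mul (t : Fin (m + 1) → ℝ) (ht : ∀ k, t k ≠ 0) (K : Fin m) :
    (∏ k : Fin (m + 1), mzvForm (decide (k = Fin.castSucc K ∨ k = Fin.last m)) (t k)) *
        ∏ i : Fin m, t (Fin.castSucc i) =
      t (Fin.castSucc K) / ((1 - t (Fin.castSucc K)) * (1 - t (Fin.last m))) := by
  have hl : mzvForm (decide (Fin.last m = Fin.castSucc K ∨ Fin.last m = Fin.last m)) (t (Fin.last m)) =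
      1 / (1 - t (Fin.last m)) := by simp
  have hc : ∀ i : Fin m, mzvForm (decide (Fin.castSucc i = Fin.castSucc K ∨ Fin.castSucc i = Fin.last m))
      (t (Fin.castSucc i)) = mzvForm (decide (i = K)) (t (Fin.castSucc i)) := fun i => by
    congr 1; simp [Fin.castSucc_inj, (Fin.castSucc_lt_last i).ne]
  rw [Fin.prod_univ_castSucc, hl, Finset.prod_congr rfl fun i _ => hc i]
  have hK : mzvForm (decide (K = K)) (t (Fin.castSucc K)) = 1 / (1 - t (Fin.castSucc K)) := by simp
  have h1 : (∏ i : Fin m, mzvForm (decide (i = K)) (t (Fin.castSucc i))) *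
      ∏ i : Fin m, t (Fin.castSucc i) = t (Fin.castSucc K) / (1 - t (Fin.castSucc K)) := by
    rw [← Finset.prod_mul_distrib, Finset.prod_eq_single K (fun i _ hi => by
      simp [hi, ht (Fin.castSucc i)]) (by simp), hK]
    ring
  calc (∏ i : Fin m, mzvForm (decide (i = K)) (t (Fin.castSucc i))) *
        (1 / (1 - t (Fin.last m))) * ∏ i : Fin m, t (Fin.castSucc i)
      = (∏ i : Fin m, mzvForm (decide (i = K)) (t (Fin.castSucc i))) *
        (∏ i : Fin m, t (Fin.castSucc i)) * (1 / (1 - t (Fin.last m))) := by ring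
    _ = t (Fin.castSucc K) / ((1 - t (Fin.castSucc K)) * (1 - t (Fin.last m))) := by
        rw [h1, div_mul_div_comm, mul_one]

variable {x : Fin (m + 1) → ℝ} (hx : x ∈ soloInformedOpenCube (m + 1))
include hx

/-- `|det J_κ(x)| = ∏_{i<m} t_i` on the open cube. -/
theorem soloInformed_abs_det_kappa : |(soloInformedJacCLM (soloInformedMonoPoly (m + 1)) x).det| =
    ∏ i : Fin m, soloInformedPrefixProd x (Fin.castSucc i) := by
  rw [soloInformed_det_kappa_castSucc]
  exact abs_of_pos (Finset.prod_pos fun i _ => soloInformed_prefixProd_pos hx _)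

/-- **Pull-back of `Z(m+1)` along `κ` is `1/(1 − P)`.** -/
theorem soloInformed_topWord_kappa : 1 / (1 - soloInformedPrefixProd x (Fin.last m)) =
    (∏ k : Fin (m + 1), mzvForm (decide (k = Fin.last m)) (soloInformedKappaMap (m + 1) x k)) *
      |(soloInformedJacCLM (soloInformedMonoPoly (m + 1)) x).det| := by
  rw [soloInformed_abs_det_kappa hx]
  simp only [soloInformedKappa_apply]
  exact (soloInformed_topWord_mul (fun k => soloInformedPrefixProd x k)
    (fun k => (soloInformed_prefixProd_pos hx k).ne')).symm

/-- **Pull-back of `Z(K+1, m−K)` along `κ` is `X_K/((1 − X_K)(1 − P))`.** -/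
theorem soloInformed_cutWord_kappa (K : Fin m) :
    soloInformedPrefixProd x (Fin.castSucc K) / ((1 - soloInformedPrefixProd x (Fin.castSucc K)) *
        (1 - soloInformedPrefixProd x (Fin.last m))) =
    (∏ k : Fin (m + 1), mzvForm (decide (k = Fin.castSucc K ∨ k = Fin.last m))
        (soloInformedKappaMap (m + 1) x k)) *
      |(soloInformedJacCLM (soloInformedMonoPoly (m + 1)) x).det| := by
  rw [soloInformed_abs_det_kappa hx]
  simp only [soloInformedKappa_apply]
  exact (soloInformed_cutWord_mul (fun k => soloInformedPrefixProd x k)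
    (fun k => (soloInformed_prefixProd_pos hx k).ne') K).symm

end pullback

/-! ## 3. Positivity and domination of the four integrands -/

section bounds

variable {m : ℕ}

/-- `0 ≠ 1` in `Fin (m+2)`. -/
theorem soloInformed_fin_zero_ne_one' : (0 : Fin (m + 2)) ≠ 1 := by simp

variable {x : Fin (m + 2) → ℝ} (hx : x ∈ soloInformedOpenCube (m + 2))
include hx

/-- `P ≤ x₀ x₁`. -/
theorem soloInformed_prefix_last_le : soloInformedPrefixProd x (Fin.last (m + 1)) ≤ x 0 * x 1 := by
  rw [← Finset.prod_pair (soloInformed_fin_zero_ne_one' (m := m))]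
  exact soloInformed_prod_le_prod_of_subset hx (by intro i; simp [Fin.le_last])

/-- **`1/(1 − P) ≤ W_{1/2}`.** -/
theorem soloInformed_top_le_W : 1 / (1 - soloInformedPrefixProd x (Fin.last (m + 1))) ≤
    soloInformedW (fun _ => 1 / 2) x :=
  (soloInformed_one_div_le_halfW hx 0 1 (soloInformed_prefix_last_le hx)).trans
    (soloInformed_halfW_two_le_W hx (soloInformed_fin_zero_ne_one' (m := m)))

end bounds

section cutbounds

variable {n : ℕ}

/-- The index `n+2` of `Fin (n+4)`. -/
def soloInformedPenult (n : ℕ) : Fin (n + 4) := ⟨n + 2, by omega⟩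

/-- The four indices `0, 1, n+2, n+3` are pairwise distinct. -/
theorem soloInformed_four_ne : (0 : Fin (n + 4)) ≠ 1 ∧ (0 : Fin (n + 4)) ≠ soloInformedPenult n ∧
    (0 : Fin (n + 4)) ≠ Fin.last (n + 3) ∧ (1 : Fin (n + 4)) ≠ soloInformedPenult n ∧
    (1 : Fin (n + 4)) ≠ Fin.last (n + 3) ∧ soloInformedPenult n ≠ Fin.last (n + 3) := by
  refine ⟨?_, ?_, ?_, ?_, ?_, ?_⟩ <;>
    simp only [ne_eq, Fin.ext_iff, Fin.val_zero, Fin.val_one, Fin.val_last, soloInformedPenult] <;>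
    omega

/-- `X_K · Y_K = P`, the full product. -/
theorem soloInformed_prefix_mul_suffix (x : Fin (n + 4) → ℝ) (K : Fin (n + 4)) :
    soloInformedPrefixProd x K * soloInformedSuffixProd x K =
      soloInformedPrefixProd x (Fin.last (n + 3)) := by
  unfold soloInformedPrefixProd soloInformedSuffixProd
  rw [← Finset.prod_union (Finset.disjoint_filter.2 fun i _ h => not_lt.2 h), ← Finset.filter_or]
  congr 1
  ext i
  simpa [Fin.le_last] using le_or_gt i K

variable {K : Fin (n + 4)} (hK : 1 ≤ K.1 ∧ K.1 ≤ n + 1) {x : Fin (n + 4) → ℝ}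
  (hx : x ∈ soloInformedOpenCube (n + 4))
include hK hx

/-- `X_K ≤ x₀ x₁` for `K ≥ 1`. -/
theorem soloInformed_cut_prefix_le : soloInformedPrefixProd x K ≤ x 0 * x 1 := by
  rw [← Finset.prod_pair (soloInformed_four_ne (n := n)).1]
  refine soloInformed_prod_le_prod_of_subset hx
    (Finset.insert_subset_iff.2 ⟨?_, Finset.singleton_subset_iff.2 ?_⟩) <;>
    simp only [Finset.mem_filter, Finset.mem_univ, true_and, Fin.le_def, Fin.val_zero,
      Fin.val_one] <;>
    omega

/-- `Y_K ≤ x_{n+2} x_{n+3}` for `K ≤ n+1`. -/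
theorem soloInformed_cut_suffix_le :
    soloInformedSuffixProd x K ≤ x (soloInformedPenult n) * x (Fin.last (n + 3)) := by
  rw [← Finset.prod_pair (soloInformed_four_ne (n := n)).2.2.2.2.2]
  refine soloInformed_prod_le_prod_of_subset hx
    (Finset.insert_subset_iff.2 ⟨?_, Finset.singleton_subset_iff.2 ?_⟩) <;>
    simp only [Finset.mem_filter, Finset.mem_univ, true_and, Fin.lt_def, Fin.val_last,
      soloInformedPenult] <;>
    omega

omit hK in
/-- `P ≤ x_{n+2} x_{n+3}`. -/
theorem soloInformed_cut_top_le :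
    soloInformedPrefixProd x (Fin.last (n + 3)) ≤ x (soloInformedPenult n) * x (Fin.last (n + 3)) := by
  rw [← Finset.prod_pair (soloInformed_four_ne (n := n)).2.2.2.2.2]
  exact soloInformed_prod_le_prod_of_subset hx (by intro i; simp [Fin.le_last])

/-- `0 < 1 − Y_K` for `K ≤ n+1`. -/
theorem soloInformed_one_sub_suffix_pos : 0 < 1 - soloInformedSuffixProd x K := by
  have h : soloInformedSuffixProd x K < 1 :=
    soloInformed_prod_lt_one hx (j := Fin.last (n + 3)) (by
      simp only [Finset.mem_filter, Finset.mem_univ, true_and, Fin.lt_def, Fin.val_last]; omega)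
  linarith

omit hK in
/-- `0 < Y_K`. -/
theorem soloInformed_suffix_pos : 0 < soloInformedSuffixProd x K := Finset.prod_pos fun i _ => (hx i).1

/-- **`F_K = 1/((1 − X_K)(1 − Y_K)) ≤ W_{1/2}`.** -/
theorem soloInformed_cutF_le_W :
    1 / ((1 - soloInformedPrefixProd x K) * (1 - soloInformedSuffixProd x K)) ≤
      soloInformedW (fun _ => 1 / 2) x := by
  obtain ⟨h01, h02, h03, h12, h13, h23⟩ := soloInformed_four_ne (n := n)
  rw [← one_div_mul_one_div]
  refine (mul_le_mul (soloInformed_one_div_le_halfW hx 0 1 (soloInformed_cut_prefix_le hK hx))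
    (soloInformed_one_div_le_halfW hx _ _ (soloInformed_cut_suffix_le hK hx))
    (one_div_pos.2 (soloInformed_one_sub_suffix_pos hK hx)).le
    (mul_nonneg (soloInformed_halfW_nonneg hx 0) (soloInformed_halfW_nonneg hx 1))).trans ?_
  exact soloInformed_halfW_four_le_W hx h01 h02 h03 h12 h13 h23

/-- **`1/((1 − X_K)(1 − P)) ≤ W_{1/2}`.** -/
theorem soloInformed_cutQ_le_W :
    1 / ((1 - soloInformedPrefixProd x K) * (1 - soloInformedPrefixProd x (Fin.last (n + 3)))) ≤
      soloInformedW (fun _ => 1 / 2) x := by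
  obtain ⟨h01, h02, h03, h12, h13, h23⟩ := soloInformed_four_ne (n := n)
  rw [← one_div_mul_one_div]
  refine (mul_le_mul (soloInformed_one_div_le_halfW hx 0 1 (soloInformed_cut_prefix_le hK hx))
    (soloInformed_one_div_le_halfW hx _ _ (soloInformed_cut_top_le hx))
    (one_div_pos.2 (soloInformed_one_sub_prefix_pos hx _)).le
    (mul_nonneg (soloInformed_halfW_nonneg hx 0) (soloInformed_halfW_nonneg hx 1))).trans ?_
  exact soloInformed_halfW_four_le_W hx h01 h02 h03 h12 h13 h23

/-- **`Q_K = X_K/((1 − X_K)(1 − P)) ≤ W_{1/2}`.** -/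
theorem soloInformed_cutQ1_le_W :
    soloInformedPrefixProd x K /
        ((1 - soloInformedPrefixProd x K) * (1 - soloInformedPrefixProd x (Fin.last (n + 3)))) ≤
      soloInformedW (fun _ => 1 / 2) x := by
  refine le_trans ?_ (soloInformed_cutQ_le_W hK hx)
  rw [div_eq_mul_one_div]
  refine mul_le_of_le_one_left (one_div_pos.2 (mul_pos (soloInformed_one_sub_prefix_pos hx _)
    (soloInformed_one_sub_prefix_pos hx _))).le ?_
  exact (soloInformed_prod_lt_one hx (j := K) (by simp)).le

/-- **`C_K = 1/((1 − Y_K)(1 − P)) ≤ W_{1/2}`.** -/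
theorem soloInformed_cutC_le_W :
    1 / ((1 - soloInformedSuffixProd x K) * (1 - soloInformedPrefixProd x (Fin.last (n + 3)))) ≤
      soloInformedW (fun _ => 1 / 2) x := by
  obtain ⟨h01, h02, h03, h12, h13, h23⟩ := soloInformed_four_ne (n := n)
  rw [← one_div_mul_one_div]
  refine (mul_le_mul (soloInformed_one_div_le_halfW hx _ _ (soloInformed_cut_suffix_le hK hx))
    (soloInformed_one_div_le_halfW hx 0 1 (soloInformed_prefix_last_le hx))
    (one_div_pos.2 (soloInformed_one_sub_prefix_pos hx _)).le
    (mul_nonneg (soloInformed_halfW_nonneg hx _) (soloInformed_halfW_nonneg hx _))).trans ?_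
  exact soloInformed_halfW_four_le_W hx h23 h02.symm h12.symm h03.symm h13.symm h01

omit hK in
/-- `0 < 1 − P`. -/
theorem soloInformed_one_sub_top_pos : 0 < 1 - soloInformedPrefixProd x (Fin.last (n + 3)) :=
  soloInformed_one_sub_prefix_pos hx _

/-! ## 4. The partial-fraction identity -/

/-- **`1/((1 − X)(1 − Y)) = X/((1 − X)(1 − XY)) + 1/((1 − Y)(1 − XY))`** on the cube. -/
theorem soloInformed_cut_partial_fraction :
    1 / ((1 - soloInformedPrefixProd x K) * (1 - soloInformedSuffixProd x K)) =
      soloInformedPrefixProd x K /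
          ((1 - soloInformedPrefixProd x K) * (1 - soloInformedPrefixProd x (Fin.last (n + 3)))) +
        1 / ((1 - soloInformedSuffixProd x K) * (1 - soloInformedPrefixProd x (Fin.last (n + 3)))) := by
  rw [← soloInformed_prefix_mul_suffix x K]
  have ha := (soloInformed_one_sub_prefix_pos hx K).ne'
  have hb := (soloInformed_one_sub_suffix_pos hK hx).ne'
  have hc : 1 - soloInformedPrefixProd x K * soloInformedSuffixProd x K ≠ 0 := by
    rw [soloInformed_prefix_mul_suffix]; exact (soloInformed_one_sub_top_pos hx).ne'
  field_simp
  ring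

end cutbounds

end Summit.KontsevichZagierPeriods.KontsevichZagierPeriods.Theorems
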